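/-
Origin: expansion seat `planner-pub-hodgecm-pv13-g4-0`, handover #4 2026-08-18T10:30:32Z (`HOME/pub-hodgecm-pv13-g4/lean/Pv13g4/GenuineSchrodingerContinuity.lean`, md5 abeed2cb, 241 lines);
landed by the gen-7 packager in gate run 28 as `HodgeCM/PerL34/GenuineSchrodingerContinuity.lean` (import ^import Pv[0-9]+g[0-9]+\.→import HodgeCM.PerL34. ×1).
-/
/-
Origin: pub-hodgecm-pv13-g4 (planner-pub-hodgecm-pv13-g4-0), DAG node N31f / L4.2(b) — continuity of the DERIVED local
characters `ν_v` of `GenuineSchrodingerInput` and the "N large" radius (tex ll. 617–621).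
Imports (package modules): this seat's `HodgeCM.PerL34.GenuineSchrodingerInput` (run 28; WIP module name
`Pv13g4.GenuineSchrodingerInput` ↦ that) and the landed `HodgeCM.PerL34.LocalFactors.KernelRadius` (pv07, run 19).
-/
import Summits.HodgeConjecture.HodgeCM.PerL34.GenuineSchrodingerInput
import Summits.HodgeConjecture.HodgeCM.PerL34.LocalFactors.KernelRadius
import Mathlib.Analysis.Normed.Ring.Units
import Mathlib.Analysis.InnerProductSpace.Continuous

/-!
# Continuity of the derived characters `ν_v` and the "N large" radius (PerL v5 L4.2(b), tex ll. 617–621)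

For the Schrödinger-model input `X : GenuineSchrodingerInput L S Sp ω φ χ` (this seat's #3) the local character `ν_v`
at a split place is DERIVED (`X.nu`, Stone–von Neumann).  Here:

* `continuous_ωv_apply` (§1): local strong continuity of the GLOBAL `ω` along the `v`-th torus factor — the END
  theorem's own hypothesis `hloc` — makes the local factor `ω_v` strongly continuous (through the isometric
  embedding `V_v` and the base chart `baseTriv`, a homeomorphism);
* `continuous_nu` (§2): a strongly continuous `ω_v` has a CONTINUOUS `ν_v` (on the open subgroup `𝒪ˣ`,
  `ν_v(y) = ⟪1_B, ω_v(y) 1_B⟫` with `B = closedBall 0 1`, `vol B = 1`; a homomorphism continuous at `1` is continuous);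
* `exists_radius_forall_U1_nu_eq_one` (§3): hence, for every centre `x₀ ≠ 0`, a radius `r₀ ∈ (0, ‖x₀‖)` with
  `ν_v = 1` on `U1 x₀ r` for all `0 < r ≤ r₀` — the sentence "N so large that `U₁ ⊂ ker`" (tex ll. 617–621) for `ν_v`,
  by the landed `LocalFactors.exists_radius_forall_U1_eq_one` (file `KernelRadius`; no small subgroups of `S¹`).

So of #3's two "choice" fields, `hsm` (`ω_v(y) 1_D = 1_D` on `U₁`) is AVAILABLE BY CHOICE of the radius once the
centre `x₀` is fixed (`exists_radius_forall_U1_ωv_ballIndicator_eq`, §3) — it remains a field of the input only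
because the radius is tied to the global vector `φ` through `V_v(a • 1_D) = φ`, i.e. the choice belongs to whoever
builds `φ = ⊗ φ_v`.  Nothing is cited; nothing is posited; PerL / QW8 / 2001 are not used.
-/

set_option autoImplicit false

noncomputable section

open MeasureTheory MeasureTheory.Measure Set Metric Function Complex ComplexConjugate Topology Filter
open scoped RestrictedProduct InnerProductSpace NNReal ENNReal

namespace HodgeCM.PerL34.PureTensor

open HodgeCM.PerL34.LocalFactors HodgeCM.PerL34.LocalFactors.DilationModel
open HodgeCM.PerL34.LocalFactors.SchrodingerLevi HodgeCM.PerL34.LocalFactors.SchrodingerIrreducible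
open HodgeCM.PerL34.LocalModulus NumberField IsDedekindDomain
open HodgeCM.PerL34.IdelePlaces HodgeCM.PerL34.RestrictedRegroup HodgeCM.PerL34.RestrictedCutout
open HodgeCM.PerL34.IdelicTorusModel HodgeCM.PerL34.IdelicTorusModel.Genuine

attribute [local instance] LocalFactors.DilationModel.Adic.nontriviallyNormedField
  LocalFactors.DilationModel.Adic.properSpace

namespace GenuineSchrodingerInput

/-! ## §0  Two local lemmas over a non-archimedean field with compact balls -/

section local_lemmas

variable {F : Type} [NormedField F] [IsUltrametricDist F] [ProperSpace F] {n : ℕ}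
  [MeasurableSpace (Fin n → F)] [BorelSpace (Fin n → F)]
  (μ : Measure (Fin n → F)) [μ.IsAddHaarMeasure]

/-- **A strongly continuous dilation representation has a continuous character**, provided the closed unit ball
has measure `≠ 0, ⊤` (any Haar measure): on the open subgroup `{|y| = 1}`,
`ν(y) · vol B = ⟪1_B, ω_ν(y) 1_B⟫` (`inner_indicator_dilationRep`, `B ∩ y⁻¹B = B`). -/
theorem continuous_of_continuous_dilationRep (ν : Fˣ →* Circle)
    (hcont : ∀ f : Lp ℂ 2 μ, Continuous fun y : Fˣ => dilationRep μ ν y f) : Continuous ν := by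
  have hB : MeasurableSet (closedBall (0 : Fin n → F) 1) := measurableSet_closedBall
  have hBμ : μ (closedBall (0 : Fin n → F) 1) ≠ ⊤ := (isCompact_closedBall _ _).measure_lt_top.ne
  have hBμ0 : μ (closedBall (0 : Fin n → F) 1) ≠ 0 :=
    (IsUltrametricDist.isOpen_closedBall (0 : Fin n → F) one_ne_zero).measure_ne_zero μ
      ⟨0, mem_closedBall_self zero_le_one⟩
  have hm : (μ.real (closedBall (0 : Fin n → F) 1) : ℂ) ≠ 0 := by
    rw [Ne, Complex.ofReal_eq_zero, measureReal_def, ENNReal.toReal_eq_zero_iff, not_or]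
    exact ⟨hBμ0, hBμ⟩
  apply continuous_of_continuousAt_one
  -- (`Circle`'s topology is the subtype topology: transfer `ContinuousAt` through the inducing coercion to `ℂ`)
  refine (Topology.IsInducing.subtypeVal.continuousAt_iff (f := (ν : Fˣ → Circle)) (x := (1 : Fˣ))).2 ?_
  have hU : {y : Fˣ | ‖(y : F)‖ = 1} ∈ 𝓝 (1 : Fˣ) := by
    have ho : IsOpen {y : Fˣ | ‖(y : F)‖ = 1} := by
      have hs : {y : Fˣ | ‖(y : F)‖ = 1} = Units.val ⁻¹' sphere (0 : F) 1 := by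
        ext y
        simp only [mem_setOf_eq, mem_preimage, mem_sphere, dist_zero_right]
      rw [hs]
      exact (IsUltrametricDist.isOpen_sphere (0 : F) one_ne_zero).preimage Units.continuous_val
    exact ho.mem_nhds (by simp only [mem_setOf_eq, Units.val_one, norm_one])
  -- the continuous function agreeing with `ν` near `1`
  have hc : Continuous fun y : Fˣ =>
      ⟪indicatorConstLp 2 hB hBμ (1 : ℂ), dilationRep μ ν y (indicatorConstLp 2 hB hBμ (1 : ℂ))⟫_ℂ
        * (μ.real (closedBall (0 : Fin n → F) 1) : ℂ)⁻¹ :=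
    (continuous_const.inner (hcont _)).mul continuous_const
  refine hc.continuousAt.congr ?_
  filter_upwards [hU] with y hy
  rw [Function.comp_apply, inner_indicator_dilationRep, weight_eq_of_norm_eq_one ν y hy,
    preimage_smul_closedBall_zero y hy, inter_self, mul_assoc, mul_inv_cancel₀ hm, mul_one]

omit [IsUltrametricDist F] [ProperSpace F] in
open scoped Classical in
/-- the extension by `1` at `0` of a continuous unitary character of `Fˣ` is continuous at `1 ∈ F`
(`Units.val` is an open embedding; `F` is complete, so `Fˣ` carries summable geometric series). -/
theorem continuousAt_extend_one [CompleteSpace F] (ν : Fˣ →* Circle) (hν : Continuous ν) :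
    ContinuousAt (fun x : F => if hx : x = 0 then (1 : Circle) else ν (Units.mk0 x hx)) (1 : F) := by
  have hcomp : ((fun x : F => if hx : x = 0 then (1 : Circle) else ν (Units.mk0 x hx)) ∘ Units.val) = ν := by
    funext u
    simp only [Function.comp_apply, dif_neg u.ne_zero, Units.mk0_val]
  have key : Filter.map (Units.val : Fˣ → F) (𝓝 (1 : Fˣ)) = 𝓝 (1 : F) := by
    rw [Units.isOpenEmbedding_val.map_nhds_eq, Units.val_one]
  rw [ContinuousAt, ← key, Filter.tendsto_map'_iff, hcomp]
  have h1 : (if hx : (1 : F) = 0 then (1 : Circle) else ν (Units.mk0 (1 : F) hx)) = ν 1 := by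
    rw [dif_neg one_ne_zero, Units.mk0_one]
  rw [h1]
  exact hν.continuousAt

omit [MeasurableSpace (Fin n → F)] [BorelSpace (Fin n → F)] in
open scoped Classical in
/-- **"N large" for a continuous `ν`** (tex ll. 617–621): for every centre `x₀ ≠ 0` there is `r₀ ∈ (0, ‖x₀‖)` with
`ν = 1` on `U1 x₀ r` for all `0 < r ≤ r₀` (`LocalFactors.exists_radius_forall_U1_eq_one`, file `KernelRadius`, at the extension by `1`). -/
theorem exists_radius_forall_U1_eq_one_of_continuous (ν : Fˣ →* Circle) (hν : Continuous ν)
    {x₀ : Fin n → F} (hx : x₀ ≠ 0) :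
    ∃ r₀ : ℝ, 0 < r₀ ∧ r₀ < ‖x₀‖ ∧
      ∀ r : ℝ, 0 < r → r ≤ r₀ → ∀ y : Fˣ, (y : F) ∈ U1 x₀ r → ν y = 1 := by
  set χ : F → Circle := fun x => if hx : x = 0 then (1 : Circle) else ν (Units.mk0 x hx) with hχ
  have hχu : ∀ y : Fˣ, χ (y : F) = ν y := fun y => by
    simp only [hχ, dif_neg y.ne_zero, Units.mk0_val]
  have hmul : ∀ y z : F, y ≠ 0 → z ≠ 0 → χ (y * z) = χ y * χ z := by
    intro y z hy hz
    simp only [hχ, dif_neg hy, dif_neg hz, dif_neg (mul_ne_zero hy hz), Units.mk0_mul, map_mul]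
  obtain ⟨r₀, hr₀, hr₀x, h⟩ :=
    exists_radius_forall_U1_eq_one χ hmul (continuousAt_extend_one ν hν) hx
  exact ⟨r₀, hr₀, hr₀x, fun r hr hrr y hy => by rw [← hχu]; exact h r hr hrr (y : F) hy⟩

end local_lemmas

/-! ## §1  Strong continuity of the local factor from the END hypothesis `hloc` -/

variable {L : Type} [Field L] [NumberField L] [IsCMField L]
  [DecidableEq (Place (maximalRealSubfield L))]
  [∀ v : HeightOneSpectrum (𝓞 (maximalRealSubfield L)), MeasurableSpace (v.adicCompletion (maximalRealSubfield L))]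
  [∀ v : HeightOneSpectrum (𝓞 (maximalRealSubfield L)), BorelSpace (v.adicCompletion (maximalRealSubfield L))]
  {S : Finset (Place (maximalRealSubfield L))}
  {Sp : Type} [NormedAddCommGroup Sp] [InnerProductSpace ℂ Sp]
  {ω : Model L →* (Sp ≃ₗᵢ[ℂ] Sp)} {φ : Sp} {χ : Model L →* Circle}
  (X : GenuineSchrodingerInput L S Sp ω φ χ)

/-- **local strong continuity of `ω` along the `v`-th torus factor ⇒ strong continuity of the local factor `ω_v`**
(`V_v` is an isometric embedding, `baseTriv` a homeomorphism). -/
theorem continuous_ωv_apply (i : Place (maximalRealSubfield L)) (hs : IsSplitPlace L i)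
    (hloc : ∀ v : Sp, Continuous fun g : locTorus (maximalRealSubfield L) L i =>
      ω (RestrictedProduct.mulSingle (genLevel L) i g) v)
    (f : Lp ℂ 2 (Adic.muV (maximalRealSubfield L) (basePlaceOf L i))) :
    Continuous fun y : ((basePlaceOf L i).adicCompletion (maximalRealSubfield L))ˣ => X.ωv i y f := by
  have h1 : Continuous fun g : locTorus (maximalRealSubfield L) L i => X.V i hs (X.ωv i (baseTriv L i hs g) f) := by
    simp_rw [← X.hV i hs]
    exact hloc (X.V i hs f)
  have h2 : Continuous fun g : locTorus (maximalRealSubfield L) L i => X.ωv i (baseTriv L i hs g) f :=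
    (X.V i hs).isometry.isEmbedding.continuous_iff.2 h1
  have h3 : (fun y : ((basePlaceOf L i).adicCompletion (maximalRealSubfield L))ˣ => X.ωv i y f)
      = (fun g : locTorus (maximalRealSubfield L) L i => X.ωv i (baseTriv L i hs g) f) ∘ (baseTriv L i hs).symm := by
    funext y
    simp only [Function.comp_apply, ContinuousMulEquiv.apply_symm_apply]
  rw [h3]
  exact h2.comp (baseTriv L i hs).symm.continuous

/-! ## §2  Continuity of `ν_v` -/

/-- **a strongly continuous local factor has a continuous `ν_v`.** -/
theorem continuous_nu (i : Place (maximalRealSubfield L)) (hs : IsSplitPlace L i)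
    (hcont : ∀ f : Lp ℂ 2 (Adic.muV (maximalRealSubfield L) (basePlaceOf L i)),
      Continuous fun y : ((basePlaceOf L i).adicCompletion (maximalRealSubfield L))ˣ => X.ωv i y f) :
    Continuous (X.nu i) := by
  refine continuous_of_continuous_dilationRep (Adic.muV (maximalRealSubfield L) (basePlaceOf L i)) (X.nu i) ?_
  intro f
  have h := hcont f
  rw [X.ωv_eq_dilationRep i hs] at h
  exact h

/-- **`ν_v` is continuous under the END theorem's hypothesis `hloc`** (local strong continuity of the global `ω`). -/
theorem continuous_nu_of_hloc (i : Place (maximalRealSubfield L)) (hs : IsSplitPlace L i)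
    (hloc : ∀ v : Sp, Continuous fun g : locTorus (maximalRealSubfield L) L i =>
      ω (RestrictedProduct.mulSingle (genLevel L) i g) v) :
    Continuous (X.nu i) :=
  X.continuous_nu i hs (X.continuous_ωv_apply i hs hloc)

/-! ## §3  The "N large" radius for `ν_v` and for the local vector `1_D` -/

/-- **tex ll. 617–621 for the DERIVED `ν_v`**: under `hloc`, for every centre `x₀ ≠ 0` there is `r₀ ∈ (0, ‖x₀‖)` with
`ν_v = 1` on `U1 x₀ r` for all `0 < r ≤ r₀`. -/
theorem exists_radius_forall_U1_nu_eq_one (i : Place (maximalRealSubfield L)) (hs : IsSplitPlace L i)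
    (hloc : ∀ v : Sp, Continuous fun g : locTorus (maximalRealSubfield L) L i =>
      ω (RestrictedProduct.mulSingle (genLevel L) i g) v)
    {x₀ : Fin 3 → (basePlaceOf L i).adicCompletion (maximalRealSubfield L)} (hx : x₀ ≠ 0) :
    ∃ r₀ : ℝ, 0 < r₀ ∧ r₀ < ‖x₀‖ ∧ ∀ r : ℝ, 0 < r → r ≤ r₀ →
      ∀ y : ((basePlaceOf L i).adicCompletion (maximalRealSubfield L))ˣ,
        (y : (basePlaceOf L i).adicCompletion (maximalRealSubfield L)) ∈ U1 x₀ r → X.nu i y = 1 :=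
  exists_radius_forall_U1_eq_one_of_continuous (n := 3) (X.nu i) (X.continuous_nu_of_hloc i hs hloc) hx

/-- **… hence the local factor FIXES `1_D` on `U₁` for every small ball `D = closedBall x₀ r` about `x₀ ≠ 0`**:
`ω_v(y) 1_D = ν_v(y)|y|^{3/2} 1_{y⁻¹D} = 1_D` for `y ∈ U1 x₀ r`, `0 < r ≤ r₀` — the content of #3's field `hsm`
is available BY CHOICE of the radius (given the centre). -/
theorem exists_radius_forall_U1_ωv_ballIndicator_eq (i : Place (maximalRealSubfield L)) (hs : IsSplitPlace L i)
    (hloc : ∀ v : Sp, Continuous fun g : locTorus (maximalRealSubfield L) L i =>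
      ω (RestrictedProduct.mulSingle (genLevel L) i g) v)
    {x₀ : Fin 3 → (basePlaceOf L i).adicCompletion (maximalRealSubfield L)} (hx : x₀ ≠ 0) :
    ∃ r₀ : ℝ, 0 < r₀ ∧ r₀ < ‖x₀‖ ∧ ∀ r : ℝ, 0 < r → r ≤ r₀ →
      ∀ y : ((basePlaceOf L i).adicCompletion (maximalRealSubfield L))ˣ,
        (y : (basePlaceOf L i).adicCompletion (maximalRealSubfield L)) ∈ U1 x₀ r →
          X.ωv i y (ballIndicator (Adic.muV (maximalRealSubfield L) (basePlaceOf L i)) x₀ r)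
            = ballIndicator (Adic.muV (maximalRealSubfield L) (basePlaceOf L i)) x₀ r := by
  obtain ⟨r₀, hr₀, hr₀x, h⟩ := X.exists_radius_forall_U1_nu_eq_one i hs hloc hx
  refine ⟨r₀, hr₀, hr₀x, fun r hr hrr y hy => ?_⟩
  have hrx : r < ‖x₀‖ := lt_of_le_of_lt hrr hr₀x
  have hy1 : ‖(y : (basePlaceOf L i).adicCompletion (maximalRealSubfield L))‖ = 1 := norm_eq_one_of_mem_U1 hrx hy
  have hpre : (fun x : Fin 3 → (basePlaceOf L i).adicCompletion (maximalRealSubfield L) => y • x) ⁻¹' closedBall x₀ r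
      = closedBall x₀ r := by
    apply Subset.antisymm
    · intro d hd
      -- `y • d ∈ D` and `y⁻¹ ∈ U₁` ⇒ `d = y⁻¹ • (y • d) ∈ D`
      have hinv : ((y⁻¹ : ((basePlaceOf L i).adicCompletion (maximalRealSubfield L))ˣ) :
          (basePlaceOf L i).adicCompletion (maximalRealSubfield L)) ∈ U1 x₀ r := by
        rw [Units.val_inv_eq_inv_val]
        exact inv_mem_U1 hrx hy
      have h2 := ball_inter_preimage_smul_of_mem_U1 hrx hinv
      have h3 : y • d ∈ closedBall x₀ r ∩ (fun x => ((y⁻¹ : ((basePlaceOf L i).adicCompletion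
          (maximalRealSubfield L))ˣ) : (basePlaceOf L i).adicCompletion (maximalRealSubfield L)) • x) ⁻¹'
            closedBall x₀ r := by
        rw [h2]; exact hd
      have h4 := h3.2
      rwa [mem_preimage, Units.smul_def, smul_smul, Units.val_inv_eq_inv_val, inv_mul_cancel₀ y.ne_zero,
        one_smul] at h4
    · intro d hd
      have h2 := ball_inter_preimage_smul_of_mem_U1 hrx hy
      have h3 : d ∈ closedBall x₀ r ∩ (fun x => (y : (basePlaceOf L i).adicCompletion (maximalRealSubfield L)) • x) ⁻¹'
          closedBall x₀ r := by rw [h2]; exact hd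
      simpa only [mem_preimage, Units.smul_def] using h3.2
  rw [X.ωv_eq_dilationRep i hs, ballIndicator, dilationRep_indicatorConstLp, weight_eq_of_norm_eq_one (X.nu i) y hy1,
    h r hr hrr y hy, Circle.coe_one, one_smul]
  exact indicatorConstLp_set_congr _ _ _ _ _ hpre 1

end GenuineSchrodingerInput

end HodgeCM.PerL34.PureTensor

end
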